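import Literature.Analysis.FluidPDE.LocalEnergyInitialLEI
import HarnessLib

/-!
# The weak form of the equations of a local energy solution **up to a final time slice**

Analysis/FluidPDE theorem file (no new definitions) over Seregin's class
`IsLocalEnergySolutionOn T ν v₀ v π` (`LocalEnergySolutionsOn.lean`; Seregin 2014,
Def. B.1).

A local energy solution `(v, π)` solves the Navier–Stokes equations in the sense of
distributions on the open slab `(0, T) × ℝ³` (B.1.5) and is weakly continuous in time with
values in `L²_loc` on the closed interval `[0, T]` (B.1.6). Consequently the weak form holds
**up to every time slice `t₀ ∈ (0, T]` with the boundary term at `t₀`**: for every smooth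
compactly supported space–time field `ψ` on `(0, ∞) × ℝ³` (whose support may cross `t = t₀`),

`∫∫_{(0,t₀)×ℝ³} (⟪v, ∂ₜψ⟫ + ⟪v, (v·∇)ψ⟫ + ν ⟪v, Δψ⟫ + π div ψ) = ∫ ⟪v(t₀), ψ(t₀)⟫ dx`

(`IsLocalEnergySolutionOn.setIntegral_weakForm_eq_final`). This is the time-reflected
companion of the accepted identity with the *initial* datum
(`weakIdentity_datum_pressure_of_distributional`, `DistributionalToWeakPressure.lean`;
Robinson–Rodrigo–Sadowski 2016, §3.1, the time integration by parts producing the boundary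
pairing), except that at a final time only **weak** continuity is available — which is all
the boundary pairing needs. Proof: test (B.1.5) with `θ_δ(t) ψ(t, x)`, `θ_δ` a smooth cut-off
equal to `1` for `t ≤ t₀ − 3δ` and to `0` for `t ≥ t₀ − δ`, `θ_δ' = −κ_δ ≤ 0` with `κ_δ` a
unit-mass kernel; then `∫∫ θ_δ Φ = ∫ κ_δ(t) g(t) dt` with `g(t) = ∫ ⟪v(t), ψ(t)⟫`, and as
`δ → 0` the left side tends to `∫∫_{t<t₀} Φ` (dominated convergence; the integrand is
integrable on the finite cylinders up to the initial time) while the right side tends to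
`g(t₀)` because `g` is continuous on `[0, T]` (`continuousOn_integral_inner_spaceTime`: weak
continuity (B.1.6) against the fixed field `ψ(t₀)` plus uniform continuity of `ψ`).

It is the ingredient that makes the concatenation of two local energy solutions at a time `t₀`
again a distributional solution (the boundary pairings at `t₀` from the left and from the right
cancel).

## References

* G. Seregin, *Lecture notes on regularity theory for the Navier–Stokes equations*, World
  Scientific (2014), App. B, Def. B.1 (B.1.5)–(B.1.6).
* J. C. Robinson, J. L. Rodrigo, W. Sadowski, *The three-dimensional Navier–Stokes equations*
  (2016), §3.1, (3.1) and Lemma 3.7 (equivalent weak formulations).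
-/

noncomputable section

open MeasureTheory TopologicalSpace Set Function Filter Metric
open _root_.Topology
open scoped ENNReal NNReal RealInnerProductSpace Laplacian

namespace Literature.Analysis.FluidPDE

/-! ## Kernels concentrating to the left of a time, against a left-continuous function -/

/-- **Approximate identity from the left against a continuous function.** Let `g` be
integrable on `[a, t₀]` and continuous at `t₀` within `[a, t₀]`, and let `κₖ ≥ 0` be continuous
unit-mass kernels supported in `(t₀ − 3δₖ, t₀ − δₖ)` with `0 < δₖ → 0` and `3δₖ ≤ t₀ − a`. Then
`∫ κₖ g → g(t₀)`. [folklore] -/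
theorem tendsto_integral_kernel_mul_of_continuousWithinAt {g : ℝ → ℝ} {a t₀ : ℝ}
    (hg : ContinuousWithinAt g (Icc a t₀) t₀) (hgi : IntegrableOn g (Icc a t₀) volume)
    {κ : ℕ → ℝ → ℝ} {δ : ℕ → ℝ} (hδ0 : ∀ k, 0 < δ k) (hδa : ∀ k, 3 * δ k ≤ t₀ - a)
    (hδ : Tendsto δ atTop (𝓝 0)) (hκc : ∀ k, Continuous (κ k)) (hκ0 : ∀ k t, 0 ≤ κ k t)
    (hκsupp : ∀ k t, κ k t ≠ 0 → t ∈ Ioo (t₀ - 3 * δ k) (t₀ - δ k)) (hκ1 : ∀ k, ∫ t, κ k t = 1) :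
    Tendsto (fun k => ∫ t, κ k t * g t) atTop (𝓝 (g t₀)) := by
  rw [Metric.tendsto_atTop]
  intro ε hε
  obtain ⟨d, hd, hdg⟩ := Metric.continuousWithinAt_iff.1 hg (ε / 2) (half_pos hε)
  have hev : ∀ᶠ k in atTop, 3 * δ k < d := by
    have h3 : Tendsto (fun k => 3 * δ k) atTop (𝓝 (3 * 0)) := hδ.const_mul 3
    rw [mul_zero] at h3
    exact (tendsto_order.1 h3).2 d hd
  obtain ⟨N, hN⟩ := eventually_atTop.1 hev
  refine ⟨N, fun k hk => ?_⟩
  have hk' : 3 * δ k < d := hN k hk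
  -- support and boundedness of the kernel
  have hsupp : support (κ k) ⊆ Ioo (t₀ - 3 * δ k) (t₀ - δ k) := fun t ht => hκsupp k t ht
  have hsuppIcc : Ioo (t₀ - 3 * δ k) (t₀ - δ k) ⊆ Icc a t₀ := fun t ht =>
    ⟨by linarith [ht.1, hδa k], by linarith [ht.2, hδ0 k]⟩
  have hκcs : HasCompactSupport (κ k) :=
    HasCompactSupport.of_support_subset_isCompact isCompact_Icc
      (hsupp.trans (hsuppIcc.trans Subset.rfl))
  obtain ⟨C, hC⟩ := (hκc k).bounded_above_of_compact_support hκcs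
  -- integrability of `κ g` and `κ`
  have hκi : Integrable (κ k) volume := (hκc k).integrable_of_hasCompactSupport hκcs
  have hκgi : Integrable (fun t => κ k t * g t) volume := by
    have h1 : IntegrableOn (fun t => κ k t * g t) (Icc a t₀) volume :=
      hgi.bdd_mul (hκc k).aestronglyMeasurable.restrict (Eventually.of_forall fun t => hC t)
    refine (integrableOn_iff_integrable_of_support_subset ?_).1 h1
    intro t ht
    exact hsuppIcc (hsupp (left_ne_zero_of_mul (mem_support.1 ht)))
  -- the estimate
  have hdiff : (∫ t, κ k t * g t) - g t₀ = ∫ t, κ k t * (g t - g t₀) := by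
    have e1 : (fun t => κ k t * (g t - g t₀)) = fun t => κ k t * g t - κ k t * g t₀ := by
      funext t; ring
    rw [e1, integral_sub hκgi (hκi.mul_const _), integral_mul_const, hκ1 k, one_mul]
  rw [Real.dist_eq, hdiff]
  have hpt : ∀ t, |κ k t * (g t - g t₀)| ≤ κ k t * (ε / 2) := by
    intro t
    by_cases ht : κ k t = 0
    · rw [ht, zero_mul, zero_mul, abs_zero]
    · have htI := hκsupp k t ht
      have htIcc := hsuppIcc htI
      have hdist : dist t t₀ < d := by
        rw [Real.dist_eq, abs_sub_comm, abs_of_nonneg (by linarith [htI.2, hδ0 k])]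
        linarith [htI.1]
      have hlt : dist (g t) (g t₀) < ε / 2 := hdg htIcc hdist
      rw [Real.dist_eq] at hlt
      rw [abs_mul, abs_of_nonneg (hκ0 k t)]
      exact mul_le_mul_of_nonneg_left hlt.le (hκ0 k t)
  calc |∫ t, κ k t * (g t - g t₀)| ≤ ∫ t, |κ k t * (g t - g t₀)| := by
        rw [← Real.norm_eq_abs]
        exact (norm_integral_le_integral_norm _).trans_eq
          (integral_congr_ae (Eventually.of_forall fun t => Real.norm_eq_abs _))
    _ ≤ ∫ t, κ k t * (ε / 2) :=
        integral_mono_of_nonneg (Eventually.of_forall fun t => abs_nonneg _)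
          (hκi.mul_const _) (Eventually.of_forall hpt)
    _ = ε / 2 := by rw [integral_mul_const, hκ1 k, one_mul]
    _ < ε := half_lt_self hε

/-! ## Cut-off test fields below a final time -/

/-- **Time cut-off of a test field below a level.** If `ψ` is a test field on
`(0, ∞) × X` and `θ` is smooth with `θ = 0` on `[a, ∞)` for some `a < T`, then `θ(t) ψ(t, x)`
is a test field on the open slab `(0, T) × X`. [folklore] -/
theorem IsSpaceTimeTestOn.smul_time_of_forall_le {X F : Type*} [NormedAddCommGroup X]
    [NormedSpace ℝ X] [NormedAddCommGroup F] [NormedSpace ℝ F] {ψ : ℝ → X → F}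
    (hψ : IsSpaceTimeTestOn (slab X (Ioi 0) isOpen_Ioi) ψ) {θ : ℝ → ℝ}
    (hθ : ContDiff ℝ (⊤ : ℕ∞) θ) {a T : ℝ} (haT : a < T) (hθ0 : ∀ t, a ≤ t → θ t = 0) :
    IsSpaceTimeTestOn (slab X (Ioo 0 T) isOpen_Ioo) (fun s x => θ s • ψ s x) where
  contDiff := (hθ.comp contDiff_fst).smul hψ.contDiff
  hasCompactSupport := by
    have : uncurry (fun s x => θ s • ψ s x) = fun z : ℝ × X => θ z.1 • uncurry ψ z := rfl
    rw [this]
    exact hψ.hasCompactSupport.smul_left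
  tsupport_subset := by
    intro p hp
    have h1 : p ∈ tsupport (uncurry ψ) :=
      tsupport_smul_subset_right (fun z : ℝ × X => θ z.1) (uncurry ψ) hp
    have h0 : 0 < p.1 := mem_slab.1 (hψ.tsupport_subset h1)
    have h2 : p ∈ tsupport fun z : ℝ × X => θ z.1 :=
      tsupport_smul_subset_left (fun z : ℝ × X => θ z.1) (uncurry ψ) hp
    have h3 : (tsupport fun z : ℝ × X => θ z.1) ⊆ {z | z.1 ≤ a} := by
      refine closure_minimal (fun w hw => ?_) (isClosed_le continuous_fst continuous_const)
      by_contra h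
      exact hw (hθ0 w.1 (not_le.1 h).le)
    exact mem_slab.2 ⟨h0, (h3 h2).trans_lt haT⟩

/-! ## The pairing against a space–time test field is continuous in time -/

namespace IsLocalEnergySolutionOn

variable {T ν : ℝ} {v₀ : EuclideanSpace ℝ (Fin 3) → EuclideanSpace ℝ (Fin 3)}
  {v : ℝ → EuclideanSpace ℝ (Fin 3) → EuclideanSpace ℝ (Fin 3)}
  {π : ℝ → EuclideanSpace ℝ (Fin 3) → ℝ}

/-- **The pairing `t ↦ ∫ ⟪v(t), ψ(t)⟫` against a smooth compactly supported space–time field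
is continuous on `[0, T]`** (weak continuity (B.1.6) against the frozen field `ψ(t₀)`, and
`|∫ ⟪v(t), ψ(t) − ψ(t₀)⟫| ≤ sup |ψ(t) − ψ(t₀)| · sup_s ∫_B (1 + |v(s)|²)/2` by the every-time
local `L²` bound). [folklore] -/
theorem continuousOn_integral_inner_spaceTime (h : IsLocalEnergySolutionOn T ν v₀ v π)
    {ψ : ℝ → EuclideanSpace ℝ (Fin 3) → EuclideanSpace ℝ (Fin 3)}
    (hψ : IsSpaceTimeTestOn (⊤ : Opens (ℝ × EuclideanSpace ℝ (Fin 3))) ψ) :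
    ContinuousOn (fun t => ∫ x, ⟪v t x, ψ t x⟫) (Icc 0 T) := by
  -- the `x`-shadow and a ball around it
  obtain ⟨K₀, hK₀, hK₀t⟩ := hψ.exists_compact_slice_subset
  obtain ⟨ρ, hρ⟩ := hK₀.isBounded.subset_ball (0 : EuclideanSpace ℝ (Fin 3))
  have hψ0 : ∀ t x, x ∉ ball (0 : EuclideanSpace ℝ (Fin 3)) ρ → ψ t x = 0 := fun t x hx =>
    image_eq_zero_of_notMem_tsupport fun h' => hx (hρ (hK₀t t h'))
  obtain ⟨C, hC⟩ := h.exists_forall_lintegral_ball_le ρ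
  -- `∫_B ‖v s‖ ≤ (|B| + C) / 2 =: C'` for all `s ∈ [0, T]`
  set VB : ℝ := ((volume : Measure (EuclideanSpace ℝ (Fin 3))) (ball 0 ρ)).toReal with hVB
  set C' : ℝ := (VB + C) / 2 + 1 with hC'
  have hC'pos : 0 < C' := by
    have : 0 ≤ VB := ENNReal.toReal_nonneg
    have : (0 : ℝ) ≤ C := C.2
    simp only [hC']; linarith
  have hL1 : ∀ s ∈ Icc 0 T, ∫ x in ball 0 ρ, ‖v s x‖ ≤ (VB + C) / 2 := by
    intro s hs
    have hvs : MemLp (v s) 2 (volume.restrict (ball 0 ρ)) := h.memLp_two_restrict_ball hs 0 ρ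
    have hsq : Integrable (fun x => ‖v s x‖ ^ 2) (volume.restrict (ball 0 ρ)) :=
      (memLp_two_iff_integrable_sq_norm hvs.1).1 hvs
    haveI : IsFiniteMeasure (volume.restrict (ball (0 : EuclideanSpace ℝ (Fin 3)) ρ)) :=
      ⟨by rw [Measure.restrict_apply_univ]; exact measure_ball_lt_top⟩
    have hone : Integrable (fun _ : EuclideanSpace ℝ (Fin 3) => (1 : ℝ)) (volume.restrict (ball 0 ρ)) :=
      integrable_const _
    have hpt : ∀ x, ‖v s x‖ ≤ (1 + ‖v s x‖ ^ 2) / 2 := fun x => by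
      nlinarith [sq_nonneg (‖v s x‖ - 1), norm_nonneg (v s x)]
    have hsqle : ∫ x in ball 0 ρ, ‖v s x‖ ^ 2 ≤ C := by
      have e1 : ∫ x in ball 0 ρ, ‖v s x‖ ^ 2 =
          (∫⁻ x in ball 0 ρ, ENNReal.ofReal (‖v s x‖ ^ 2)).toReal :=
        integral_eq_lintegral_of_nonneg_ae (Eventually.of_forall fun x => by positivity)
          hsq.aestronglyMeasurable
      have e2 : ∫⁻ x in ball 0 ρ, ENNReal.ofReal (‖v s x‖ ^ 2) = ∫⁻ x in ball 0 ρ, ‖v s x‖ₑ ^ 2 := by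
        refine lintegral_congr fun x => ?_
        rw [← ofReal_norm, ENNReal.ofReal_pow (norm_nonneg _)]
      rw [e1, e2]
      calc (∫⁻ x in ball 0 ρ, ‖v s x‖ₑ ^ 2).toReal ≤ ((C : ℝ≥0∞)).toReal :=
            ENNReal.toReal_mono ENNReal.coe_ne_top (hC s hs 0)
        _ = C := ENNReal.coe_toReal C
    calc ∫ x in ball 0 ρ, ‖v s x‖ ≤ ∫ x in ball 0 ρ, (1 + ‖v s x‖ ^ 2) / 2 :=
          integral_mono_of_nonneg (Eventually.of_forall fun x => norm_nonneg _)
            ((hone.add hsq).div_const 2) (Eventually.of_forall hpt)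
      _ = (VB + ∫ x in ball 0 ρ, ‖v s x‖ ^ 2) / 2 := by
          rw [integral_div, integral_add hone hsq, integral_const, smul_eq_mul, mul_one]
          simp only [Measure.real, Measure.restrict_apply_univ, hVB]
      _ ≤ (VB + C) / 2 := by linarith
  -- continuity at a point `t₀ ∈ [0, T]`
  intro t₀ ht₀
  rw [Metric.continuousWithinAt_iff]
  intro ε hε
  -- (i) weak continuity against the frozen field `ψ t₀`
  have htest : FunctionSpaces.IsTestFunctionOn (⊤ : Opens (EuclideanSpace ℝ (Fin 3))) (ψ t₀) :=
    ⟨hψ.contDiff_slice t₀, hψ.hasCompactSupport_slice t₀, fun _ _ => trivial⟩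
  have hwc := (h.weakContinuous (ψ t₀) htest) t₀ ht₀
  obtain ⟨d₁, hd₁, hd₁g⟩ := Metric.continuousWithinAt_iff.1 hwc (ε / 2) (half_pos hε)
  -- (ii) uniform continuity of `ψ` in time
  set η : ℝ := ε / 2 / C' with hη
  have hη0 : 0 < η := by positivity
  have huc : UniformContinuous (uncurry ψ) :=
    hψ.hasCompactSupport.uniformContinuous_of_continuous hψ.contDiff.continuous
  obtain ⟨d₂, hd₂, hd₂ψ⟩ := Metric.uniformContinuous_iff.1 huc η hη0
  refine ⟨min d₁ d₂, lt_min hd₁ hd₂, fun t ht hdist => ?_⟩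
  have hdist1 : dist t t₀ < d₁ := hdist.trans_le (min_le_left _ _)
  have hdist2 : dist t t₀ < d₂ := hdist.trans_le (min_le_right _ _)
  -- integrability of the pairings
  have hcs : ∀ s, Continuous (ψ s) := fun s => (hψ.contDiff_slice s).continuous
  have hcc : ∀ s, HasCompactSupport (ψ s) := fun s => hψ.hasCompactSupport_slice s
  have hi1 : Integrable (fun x => ⟪v t x, ψ t x⟫) volume := h.integrable_inner_slice ht (hcs t) (hcc t)
  have hi2 : Integrable (fun x => ⟪v t x, ψ t₀ x⟫) volume := h.integrable_inner_slice ht (hcs t₀) (hcc t₀)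
  -- the difference of the fields is uniformly small
  have hw : ∀ x, ‖ψ t x - ψ t₀ x‖ ≤ η := fun x => by
    have hd : dist ((t, x) : ℝ × EuclideanSpace ℝ (Fin 3)) (t₀, x) < d₂ := by
      rw [Prod.dist_eq, dist_self, max_eq_left dist_nonneg]
      exact hdist2
    have := hd₂ψ hd
    rw [dist_eq_norm] at this
    exact this.le
  -- `|∫ ⟪v t, ψ t − ψ t₀⟫| ≤ η (VB + C)/2 < ε/2`
  have hA : |(∫ x, ⟪v t x, ψ t x⟫) - ∫ x, ⟪v t x, ψ t₀ x⟫| ≤ η * ((VB + C) / 2) := by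
    rw [← integral_sub hi1 hi2]
    have e1 : (fun x => ⟪v t x, ψ t x⟫ - ⟪v t x, ψ t₀ x⟫) = fun x => ⟪v t x, ψ t x - ψ t₀ x⟫ := by
      funext x; rw [inner_sub_right]
    rw [e1]
    have e2 : ∫ x, ⟪v t x, ψ t x - ψ t₀ x⟫ = ∫ x in ball 0 ρ, ⟪v t x, ψ t x - ψ t₀ x⟫ := by
      refine (setIntegral_eq_integral_of_forall_compl_eq_zero fun x hx => ?_).symm
      rw [hψ0 t x hx, hψ0 t₀ x hx, sub_zero, inner_zero_right]
    rw [e2]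
    have hvt : MemLp (v t) 2 (volume.restrict (ball 0 ρ)) := h.memLp_two_restrict_ball ht 0 ρ
    haveI : IsFiniteMeasure (volume.restrict (ball (0 : EuclideanSpace ℝ (Fin 3)) ρ)) :=
      ⟨by rw [Measure.restrict_apply_univ]; exact measure_ball_lt_top⟩
    have hvL1 : Integrable (fun x => ‖v t x‖) (volume.restrict (ball 0 ρ)) :=
      (hvt.integrable one_le_two).norm
    calc |∫ x in ball 0 ρ, ⟪v t x, ψ t x - ψ t₀ x⟫|
        ≤ ∫ x in ball 0 ρ, ‖v t x‖ * η := by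
          rw [← Real.norm_eq_abs]
          refine (norm_integral_le_integral_norm _).trans ?_
          refine integral_mono_of_nonneg (Eventually.of_forall fun x => norm_nonneg _)
            (hvL1.mul_const η) (Eventually.of_forall fun x => ?_)
          exact (norm_inner_le_norm _ _).trans (mul_le_mul_of_nonneg_left (hw x) (norm_nonneg _))
      _ = η * ∫ x in ball 0 ρ, ‖v t x‖ := by rw [integral_mul_const, mul_comm]
      _ ≤ η * ((VB + C) / 2) := mul_le_mul_of_nonneg_left (hL1 t ht) hη0.le
  have hA' : |(∫ x, ⟪v t x, ψ t x⟫) - ∫ x, ⟪v t x, ψ t₀ x⟫| < ε / 2 := by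
    refine lt_of_le_of_lt hA ?_
    have h1 : η * ((VB + C) / 2) < η * C' := by
      refine mul_lt_mul_of_pos_left ?_ hη0
      simp only [hC']; linarith
    have h2 : η * C' = ε / 2 := by rw [hη]; field_simp
    linarith
  have hB : dist (∫ x, ⟪v t x, ψ t₀ x⟫) (∫ x, ⟪v t₀ x, ψ t₀ x⟫) < ε / 2 := hd₁g ht hdist1
  rw [Real.dist_eq] at hB ⊢
  have := abs_sub_lt_iff.1 hA'
  have := abs_sub_lt_iff.1 hB
  rw [abs_sub_lt_iff]
  constructor <;> linarith


/-! ## The weak form up to a final time slice -/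

/-- **The weak form of the equations up to a final time slice, with the boundary pairing.**
Let `(v, π)` be a local energy solution on `ℝ³ × (0, T)` (Seregin 2014, Def. B.1), let
`t₀ ∈ (0, T]`, and let `ψ` be a smooth compactly supported space–time field on `(0, ∞) × ℝ³`.
Then
`∫∫_{(0,t₀)×ℝ³} (⟪v, ∂ₜψ⟫ + ⟪v, (v·∇)ψ⟫ + ν ⟪v, Δψ⟫ + π div ψ) = ∫ ⟪v(t₀), ψ(t₀)⟫ dx`:
the distributional equations (B.1.5) tested with `θ_δ(t) ψ` (`θ_δ = 1` for `t ≤ t₀ − 3δ`,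
`θ_δ = 0` for `t ≥ t₀ − δ`) and `δ → 0` through the weak continuity (B.1.6) at `t₀`
(Robinson–Rodrigo–Sadowski 2016, §3.1, the time integration by parts of (3.1), here at the
final time). [folklore] -/
theorem setIntegral_weakForm_eq_final (h : IsLocalEnergySolutionOn T ν v₀ v π) {t₀ : ℝ}
    (ht₀ : t₀ ∈ Ioc 0 T)
    {ψ : ℝ → EuclideanSpace ℝ (Fin 3) → EuclideanSpace ℝ (Fin 3)}
    (hψ : IsSpaceTimeTestOn (slab (EuclideanSpace ℝ (Fin 3)) (Ioi 0) isOpen_Ioi) ψ) :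
    ∫ z in Ioo 0 t₀ ×ˢ (univ : Set (EuclideanSpace ℝ (Fin 3))),
        (⟪v z.1 z.2, timeDeriv ψ z.1 z.2⟫ + ⟪v z.1 z.2, convect (v z.1) (ψ z.1) z.2⟫ +
          ν * ⟪v z.1 z.2, Δ (ψ z.1) z.2⟫ + π z.1 z.2 * VectorCalculus.divergence (ψ z.1) z.2) =
      ∫ x, ⟪v t₀ x, ψ t₀ x⟫ := by
  have ht₀0 : 0 < t₀ := ht₀.1
  have ht₀T : t₀ ≤ T := ht₀.2
  have hT : 0 < T := ht₀0.trans_le ht₀T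
  have hψ' : IsSpaceTimeTestOn (⊤ : Opens (ℝ × EuclideanSpace ℝ (Fin 3))) ψ := hψ.mono le_top
  -- ## the compact `x`-shadow `K` and the vanishing of `ψ` and its derivatives off `K`
  obtain ⟨K₀, hK₀, hK₀t⟩ := hψ.exists_compact_slice_subset
  obtain ⟨r, hr⟩ := hK₀.isBounded.subset_closedBall (0 : EuclideanSpace ℝ (Fin 3))
  set K : Set (EuclideanSpace ℝ (Fin 3)) := closedBall 0 r with hKdef
  have hK : IsCompact K := isCompact_closedBall _ _
  have hKt : ∀ t, tsupport (ψ t) ⊆ K := fun t => (hK₀t t).trans hr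
  have hψ0 : ∀ t x, x ∉ K → ψ t x = 0 := fun t x hx =>
    image_eq_zero_of_notMem_tsupport fun h' => hx (hKt t h')
  have hψ'0 : ∀ t x, x ∉ K → timeDeriv ψ t x = 0 := fun t x hx =>
    timeDeriv_eq_zero_of_forall (fun s => hψ0 s x hx) t
  have hD0 : ∀ t x, x ∉ K → fderiv ℝ (ψ t) x = 0 := fun t x hx =>
    fderiv_of_notMem_tsupport ℝ fun h' => hx (hKt t h')
  have hL0 : ∀ t x, x ∉ K → Δ (ψ t) x = 0 := fun t x hx =>
    laplacian_eq_zero_of_notMem_tsupport fun h' => hx (hKt t h')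
  have hdiv0 : ∀ t x, x ∉ K → VectorCalculus.divergence (ψ t) x = 0 := fun t x hx => by
    simp [VectorCalculus.divergence, hD0 t x hx]
  -- continuity of the coefficient fields
  have cψ' : Continuous (uncurry (timeDeriv ψ)) := hψ.continuous_timeDeriv
  have cD : Continuous fun z : ℝ × EuclideanSpace ℝ (Fin 3) => fderiv ℝ (ψ z.1) z.2 := by
    have hh := ((hψ.isSmoothSpaceTimeOn univ).fderiv_slice uniqueDiffOn_univ).continuousOn
    rw [univ_prod_univ, continuousOn_univ] at hh
    exact hh
  have cL : Continuous fun z : ℝ × EuclideanSpace ℝ (Fin 3) => Δ (ψ z.1) z.2 := by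
    have hh := ((hψ.isSmoothSpaceTimeOn univ).laplacian uniqueDiffOn_univ).continuousOn
    rw [univ_prod_univ, continuousOn_univ] at hh
    exact hh
  obtain ⟨cdiv, -⟩ := hψ.continuous_divergence_field
  have hψd : ∀ t, Differentiable ℝ (ψ t) := fun t =>
    (hψ.contDiff_slice t).differentiable (by simp)
  have hψ2 : ∀ t, ContDiff ℝ 2 (ψ t) := fun t => contDiff_infty.1 (hψ.contDiff_slice t) 2
  -- ## integrability on the slab `(0,T) × E` (up to `t = 0`)
  set μ : Measure (ℝ × EuclideanSpace ℝ (Fin 3)) :=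
    ((volume : Measure ℝ).restrict (Ioo 0 T)).prod (volume : Measure (EuclideanSpace ℝ (Fin 3)))
    with hμ
  have hμS : (volume : Measure (ℝ × EuclideanSpace ℝ (Fin 3))).restrict
      (Ioo 0 T ×ˢ (univ : Set (EuclideanSpace ℝ (Fin 3)))) = μ := volume_restrict_slab_eq T
  obtain ⟨hUK1, hUK2⟩ := h.integrableOn_velocity hK
  have hpK := h.integrableOn_pressure hK
  have iA : Integrable (fun z : ℝ × EuclideanSpace ℝ (Fin 3) =>
      ⟪uncurry v z, uncurry (timeDeriv ψ) z⟫) μ :=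
    integrable_slab_inner hK hUK1 cψ' hψ'0
  have iB : Integrable (fun z : ℝ × EuclideanSpace ℝ (Fin 3) =>
      ⟪uncurry v z, (fderiv ℝ (ψ z.1) z.2) (uncurry v z)⟫) μ :=
    integrable_slab_inner_clm_apply hK hUK1 hUK2 cD hD0
  have iC : Integrable (fun z : ℝ × EuclideanSpace ℝ (Fin 3) => ⟪uncurry v z, Δ (ψ z.1) z.2⟫) μ :=
    integrable_slab_inner hK hUK1 cL hL0
  have iP : Integrable (fun z : ℝ × EuclideanSpace ℝ (Fin 3) =>
      uncurry π z * VectorCalculus.divergence (ψ z.1) z.2) μ :=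
    BradshawTsai2019.integrable_slab_mul hK hpK cdiv hdiv0
  set Φ : ℝ × EuclideanSpace ℝ (Fin 3) → ℝ := fun z =>
    ⟪v z.1 z.2, timeDeriv ψ z.1 z.2⟫ + ⟪v z.1 z.2, convect (v z.1) (ψ z.1) z.2⟫ +
      ν * ⟪v z.1 z.2, Δ (ψ z.1) z.2⟫ + π z.1 z.2 * VectorCalculus.divergence (ψ z.1) z.2 with hΦ
  have iΦ : Integrable Φ μ := by
    refine (((iA.add iB).add (iC.const_mul ν)).add iP).congr (Eventually.of_forall fun z => ?_)
    simp only [hΦ, uncurry, convect_apply, Pi.add_apply]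
  -- the pairing `g t = ∫ ⟪v t, ψ t⟫` and its continuity on `[0, T]`
  set g : ℝ → ℝ := fun t => ∫ x, ⟪v t x, ψ t x⟫ with hg
  have hgc : ContinuousOn g (Icc 0 T) := h.continuousOn_integral_inner_spaceTime hψ'
  -- ## cut-offs below `t₀`: `θ k t = η k (t₀ - t)`, `θ' = -κ k`, `κ k t = ρ k (t₀ - t)`
  set δ : ℕ → ℝ := fun k => t₀ / (6 * ((k : ℝ) + 1)) with hδ
  have hδ0 : ∀ k, 0 < δ k := fun k => by positivity
  have hδt : ∀ k, 3 * δ k ≤ t₀ / 2 := fun k => by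
    have hk : (0 : ℝ) ≤ k := Nat.cast_nonneg k
    have h1 : δ k ≤ t₀ / 6 := by
      show t₀ / (6 * ((k : ℝ) + 1)) ≤ t₀ / 6
      exact div_le_div_of_nonneg_left ht₀0.le (by norm_num) (by nlinarith)
    linarith
  have hδlim : Tendsto δ atTop (𝓝 0) := by
    have h1 : Tendsto (fun k : ℕ => (k : ℝ) + 1) atTop atTop :=
      tendsto_atTop_add_const_right _ 1 tendsto_natCast_atTop_atTop
    have h2 : Tendsto (fun k : ℕ => 6 * ((k : ℝ) + 1)) atTop atTop :=
      h1.const_mul_atTop (by norm_num)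
    exact tendsto_const_nhds.div_atTop h2
  obtain hcut : ∀ k, ∃ η ρ : ℝ → ℝ, ContDiff ℝ (⊤ : ℕ∞) η ∧ Continuous ρ ∧
      (∀ s, HasDerivAt η (ρ s) s) ∧ (∀ s, s ≤ δ k → η s = 0) ∧ (∀ s, 3 * δ k ≤ s → η s = 1) ∧
      (∀ s, η s ∈ Icc (0 : ℝ) 1) ∧ (∀ s, 0 ≤ ρ s) ∧ (∀ s, s ∉ Ioo (δ k) (3 * δ k) → ρ s = 0) ∧
      ∫ s, ρ s = 1 := fun k => exists_smooth_time_cutoff (hδ0 k)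
  choose η ρ hηs hρc hηρ hη0 hη1 hη01 hρ0 hρsupp hρ1 using hcut
  set θ : ℕ → ℝ → ℝ := fun k t => η k (t₀ - t) with hθ
  set κ : ℕ → ℝ → ℝ := fun k t => ρ k (t₀ - t) with hκ
  have hθs : ∀ k, ContDiff ℝ (⊤ : ℕ∞) (θ k) := fun k =>
    (hηs k).comp (contDiff_const.sub contDiff_id)
  have hθd : ∀ k t, HasDerivAt (θ k) (-κ k t) t := by
    intro k t
    have h1 : HasDerivAt (fun s : ℝ => t₀ - s) (-1) t := by
      simpa using (hasDerivAt_id t).const_sub t₀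
    have h2 : HasDerivAt (fun s => η k (t₀ - s)) (ρ k (t₀ - t) * (-1)) t :=
      (hηρ k (t₀ - t)).comp t h1
    have e : ρ k (t₀ - t) * (-1) = -κ k t := by simp only [hκ]; ring
    rw [e] at h2
    exact h2
  have hθ_one : ∀ k t, t ≤ t₀ - 3 * δ k → θ k t = 1 := fun k t ht =>
    hη1 k (t₀ - t) (by linarith)
  have hθ_zero : ∀ k t, t₀ - δ k ≤ t → θ k t = 0 := fun k t ht =>
    hη0 k (t₀ - t) (by linarith)
  have hθ01 : ∀ k t, θ k t ∈ Icc (0 : ℝ) 1 := fun k t => hη01 k (t₀ - t)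
  have hθabs : ∀ k t, |θ k t| ≤ 1 := fun k t => by
    rw [abs_le]; exact ⟨by linarith [(hθ01 k t).1], (hθ01 k t).2⟩
  have hκc : ∀ k, Continuous (κ k) := fun k => (hρc k).comp (continuous_const.sub continuous_id)
  have hκ0 : ∀ k t, 0 ≤ κ k t := fun k t => hρ0 k (t₀ - t)
  have hκsupp : ∀ k t, κ k t ≠ 0 → t ∈ Ioo (t₀ - 3 * δ k) (t₀ - δ k) := by
    intro k t ht
    by_contra hnot
    refine ht (hρsupp k (t₀ - t) fun hmem => hnot ?_)
    exact ⟨by linarith [hmem.2], by linarith [hmem.1]⟩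
  have hκ1 : ∀ k, ∫ t, κ k t = 1 := fun k => by
    simp only [hκ]
    rw [integral_sub_left_eq_self (ρ k) volume t₀]
    exact hρ1 k
  have hκC : ∀ k, ∃ C, ∀ t, |κ k t| ≤ C := fun k => by
    obtain ⟨C, -, hC⟩ := exists_abs_le_of_eq_zero_off_Ioo (hρc k) (hρsupp k)
    exact ⟨C, fun t => hC (t₀ - t)⟩
  -- ## the tested identity for each `k`: `∫ θ_k Φ dμ = ∫ κ_k ⟪v, ψ⟫ dμ`
  have hmom := h.suitable.distributional.2.2.2.2
  have hstep : ∀ k, ∫ z, θ k z.1 * Φ z ∂μ = ∫ z, κ k z.1 * ⟪v z.1 z.2, ψ z.1 z.2⟫ ∂μ := by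
    intro k
    have hψk : IsSpaceTimeTestOn (slab (EuclideanSpace ℝ (Fin 3)) (Ioo 0 T) isOpen_Ioo)
        (fun s x => θ k s • ψ s x) :=
      hψ.smul_time_of_forall_le (hθs k) (a := t₀ - δ k) (by linarith [hδ0 k]) (hθ_zero k)
    have key := hmom _ hψk
    -- rewrite the integrand pointwise
    have hpt : ∀ z : ℝ × EuclideanSpace ℝ (Fin 3),
        (⟪v z.1 z.2, timeDeriv (fun s x => θ k s • ψ s x) z.1 z.2⟫ +
          ⟪v z.1 z.2, convect (v z.1) ((fun s x => θ k s • ψ s x) z.1) z.2⟫ +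
          ν * ⟪v z.1 z.2, Δ ((fun s x => θ k s • ψ s x) z.1) z.2⟫ +
          π z.1 z.2 * VectorCalculus.divergence ((fun s x => θ k s • ψ s x) z.1) z.2 +
          ⟪(0 : ℝ → EuclideanSpace ℝ (Fin 3) → EuclideanSpace ℝ (Fin 3)) z.1 z.2,
            (fun s x => θ k s • ψ s x) z.1 z.2⟫) =
        θ k z.1 * Φ z + (-κ k z.1) * ⟪v z.1 z.2, ψ z.1 z.2⟫ := by
      intro z
      dsimp only
      rw [timeDeriv_cutoff (hθd k) hψ.hasDerivAt_time, convect_fun_const_smul _ (hψd z.1 z.2),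
        laplacian_fun_const_smul (hψ2 z.1), divergence_fun_const_smul (hψd z.1 z.2)]
      simp only [hΦ, inner_add_right, real_inner_smul_right, Pi.zero_apply, inner_zero_left]
      ring
    have key' : ∫ z, (θ k z.1 * Φ z + (-κ k z.1) * ⟪v z.1 z.2, ψ z.1 z.2⟫) ∂μ = 0 := by
      rw [← hμS, ← setIntegral_congr_fun (measurableSet_Ioo.prod MeasurableSet.univ)
        (fun z _ => hpt z)]
      exact key
    -- split the integral
    obtain ⟨Cκ, hCκ⟩ := hκC k
    have i1 : Integrable (fun z : ℝ × EuclideanSpace ℝ (Fin 3) => θ k z.1 * Φ z) μ :=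
      integrable_time_mul iΦ (hθs k).continuous (hθabs k)
    have iU : Integrable (fun z : ℝ × EuclideanSpace ℝ (Fin 3) => ⟪v z.1 z.2, ψ z.1 z.2⟫) μ :=
      integrable_slab_inner hK hUK1 hψ.contDiff.continuous hψ0
    have i2 : Integrable (fun z : ℝ × EuclideanSpace ℝ (Fin 3) =>
        (-κ k z.1) * ⟪v z.1 z.2, ψ z.1 z.2⟫) μ :=
      integrable_time_mul iU (hκc k).neg (C := Cκ) fun s => by
        rw [Pi.neg_apply, abs_neg]; exact hCκ s
    have key := key'
    rw [integral_add i1 i2] at key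
    have e2 : ∫ z, (-κ k z.1) * ⟪v z.1 z.2, ψ z.1 z.2⟫ ∂μ =
        -∫ z, κ k z.1 * ⟪v z.1 z.2, ψ z.1 z.2⟫ ∂μ := by
      rw [← integral_neg]
      refine integral_congr_ae (Eventually.of_forall fun z => ?_)
      ring
    rw [e2] at key
    linarith
  -- ## the limit of the left-hand sides
  have hmeasS : MeasurableSet {z : ℝ × EuclideanSpace ℝ (Fin 3) | z.1 < t₀} :=
    measurableSet_lt measurable_fst measurable_const
  have hlimL : Tendsto (fun k => ∫ z, θ k z.1 * Φ z ∂μ) atTop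
      (𝓝 (∫ z in {z : ℝ × EuclideanSpace ℝ (Fin 3) | z.1 < t₀}, Φ z ∂μ)) := by
    rw [← integral_indicator hmeasS]
    refine tendsto_integral_of_dominated_convergence (fun z => ‖Φ z‖)
      (fun k => (integrable_time_mul iΦ (hθs k).continuous (hθabs k)).aestronglyMeasurable)
      iΦ.norm (fun k => Eventually.of_forall fun z => ?_) (Eventually.of_forall fun z => ?_)
    · rw [norm_mul, Real.norm_eq_abs]
      exact mul_le_of_le_one_left (norm_nonneg _) (hθabs k z.1)
    · by_cases hz : z.1 < t₀
      · rw [indicator_of_mem (show z ∈ {z : ℝ × EuclideanSpace ℝ (Fin 3) | z.1 < t₀} from hz)]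
        have hev : ∀ᶠ k in atTop, θ k z.1 * Φ z = Φ z := by
          have h3 : Tendsto (fun k => 3 * δ k) atTop (𝓝 (3 * 0)) := hδlim.const_mul 3
          rw [mul_zero] at h3
          filter_upwards [(tendsto_order.1 h3).2 (t₀ - z.1) (by linarith)] with k hk
          rw [hθ_one k z.1 (by linarith), one_mul]
        exact tendsto_const_nhds.congr' (hev.mono fun k hk => hk.symm)
      · rw [indicator_of_notMem (show z ∉ {z : ℝ × EuclideanSpace ℝ (Fin 3) | z.1 < t₀} from hz)]
        refine tendsto_const_nhds.congr fun k => ?_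
        rw [hθ_zero k z.1 (by linarith [hδ0 k, not_lt.1 hz]), zero_mul]
  -- the limit set integral is the integral over `(0, t₀) × E`
  have hLset : ∫ z in {z : ℝ × EuclideanSpace ℝ (Fin 3) | z.1 < t₀}, Φ z ∂μ =
      ∫ z in Ioo 0 t₀ ×ˢ (univ : Set (EuclideanSpace ℝ (Fin 3))), Φ z := by
    have hset : {z : ℝ × EuclideanSpace ℝ (Fin 3) | z.1 < t₀} ∩
        Ioo 0 T ×ˢ (univ : Set (EuclideanSpace ℝ (Fin 3))) =
        Ioo 0 t₀ ×ˢ (univ : Set (EuclideanSpace ℝ (Fin 3))) := by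
      ext z
      simp only [mem_inter_iff, mem_setOf_eq, mem_prod, mem_Ioo, mem_univ, and_true]
      constructor
      · rintro ⟨h1, h2, h3⟩; exact ⟨h2, h1⟩
      · rintro ⟨h1, h2⟩; exact ⟨h2, h1, h2.trans_le ht₀T⟩
    rw [← hμS, Measure.restrict_restrict hmeasS, hset]
  -- ## the limit of the right-hand sides
  have hRk : ∀ k, ∫ z, κ k z.1 * ⟪v z.1 z.2, ψ z.1 z.2⟫ ∂μ = ∫ t, κ k t * g t := by
    intro k
    obtain ⟨Cκ, hCκ⟩ := hκC k
    have iU : Integrable (fun z : ℝ × EuclideanSpace ℝ (Fin 3) => ⟪v z.1 z.2, ψ z.1 z.2⟫) μ :=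
      integrable_slab_inner hK hUK1 hψ.contDiff.continuous hψ0
    have h1 : Integrable (fun z : ℝ × EuclideanSpace ℝ (Fin 3) =>
        κ k z.1 * ⟪v z.1 z.2, ψ z.1 z.2⟫) μ := integrable_time_mul iU (hκc k) hCκ
    rw [hμ, integral_prod _ h1]
    have e1 : (fun t => ∫ x, κ k (t, x).1 * ⟪v (t, x).1 (t, x).2, ψ (t, x).1 (t, x).2⟫) =
        fun t => κ k t * g t := by
      funext t
      simp only [hg, ← integral_const_mul]
    rw [e1]
    refine setIntegral_eq_integral_of_forall_compl_eq_zero fun t ht => ?_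
    have hκ0' : κ k t = 0 := by
      by_contra hne
      have hmem := hκsupp k t hne
      exact ht ⟨by linarith [hmem.1, hδt k], by linarith [hmem.2, hδ0 k]⟩
    rw [hκ0', zero_mul]
  have hlimR : Tendsto (fun k => ∫ t, κ k t * g t) atTop (𝓝 (g t₀)) := by
    have hgw : ContinuousWithinAt g (Icc 0 t₀) t₀ :=
      (hgc.mono (Icc_subset_Icc_right ht₀T)) t₀ ⟨ht₀0.le, le_rfl⟩
    have hgi : IntegrableOn g (Icc 0 t₀) volume :=
      (hgc.mono (Icc_subset_Icc_right ht₀T)).integrableOn_compact isCompact_Icc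
    exact tendsto_integral_kernel_mul_of_continuousWithinAt hgw hgi hδ0
      (fun k => by linarith [hδt k]) hδlim hκc hκ0 hκsupp hκ1
  -- ## conclusion
  have hlimL' : Tendsto (fun k => ∫ t, κ k t * g t) atTop
      (𝓝 (∫ z in {z : ℝ × EuclideanSpace ℝ (Fin 3) | z.1 < t₀}, Φ z ∂μ)) :=
    hlimL.congr fun k => by rw [hstep k, hRk k]
  have heq := tendsto_nhds_unique hlimL' hlimR
  rw [hLset] at heq
  exact heq

end IsLocalEnergySolutionOn

end Literature.Analysis.FluidPDE
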